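import Summits.CriticalPhenomena.CardyFormulaZ2.Theses.CardyMirrorMonotone
import Literature.Probability.Percolation.InterfaceScalingLimitDiscretised
import Literature.Probability.Percolation.BoxCrossingJordan
import Literature.Probability.RandomPlanarGeometry.SLESixCrossingNondegenerate
import Literature.Probability.RandomPlanarGeometry.CritPercSLELocalityProofs
import Literature.Probability.RandomPlanarGeometry.CritPercSLELocalityItoProofs
import Literature.Probability.RandomPlanarGeometry.CritPercSLESimplePathHolds
import Literature.Probability.RandomPlanarGeometry.ConformalMapCaratheodoryProofs
import Literature.Probability.RandomPlanarGeometry.SLETargetIndependenceSix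
import Literature.Probability.RandomPlanarGeometry.SLEExistenceNeEightHolds

/-!
# Birth skeleton (BC3) for the crux `SubseqRigidity` — stmt-CriticalPhenomena-8271

Route `CardyMirrorMonotone` (rank 6; sole route wanting the item).  The crux, verbatim from
`Summits/CriticalPhenomena/CardyFormulaZ2/Theses/CardyMirrorMonotone.lean`:

    SubseqRigidity :=
      ∀ u : ℕ → ℝ, Tendsto u atTop (𝓝[>] 0) → ∀ g : ℝ → ℝ,
        (∀ R φ x, R.IsUniformizing φ x →
            Tendsto (fun n ↦ bondDomainCrossingProb R (u n)) atTop (𝓝 (g (crossRatio x)))) →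
        EqOn g cardyFunction (Ioo 0 1)

"Cardy rigidity ALONG A SEQUENCE OF MESHES: if `u n → 0⁺` and the `P_{1/2}` bond-`ℤ²` crossing
probabilities of ALL conformal rectangles converge along `u n` to `g (cross-ratio)`, then `g` is
Cardy's function on `(0,1)`."  It is the subsequential strengthening of the shared crux
`CardyRigidity` (stmt-CriticalPhenomena-0746: the same with the full mesh filter `𝓝[>] 0` in
place of the sequence `u`), and the item's informal text prescribes the same proof (Smirnov 2001
Thm 2 / Camia–Newman 2007 §§5–7 / Schramm 2000 §1.5 / Lawler–Schramm–Werner 2001 §§2–3 run with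
an UNKNOWN conformally invariant kernel).  This skeleton is that line CUT ALONG THE SEQUENCE: every
stub speaks about limits along the given mesh sequence `u` (portmanteau form
`∀ F : CurveClass ℂ →ᵇ ℝ, ∫ F (interface at mesh u n) dP_{1/2} → ∫ F dμ`, the inner clause of the
tree's `IsSubseqLimitLaw`, `SLEConvergenceCriterion.lean`), so that each stub is the sequential
form of the corresponding stub of the registered line `Lines/kappa_free_splitting.lean` of the
shared crux `CardyRigidity` (a proof of a stub here specialises to that one along
`u n = 1/(n+1)`), and every step that is already a tree theorem is USED in the composition.

Notation (informal; the stubs inline it over tree declarations only):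
* `SHYP u g` := `∀ R φ x, R.IsUniformizing φ x → Tendsto (fun n ↦ bondDomainCrossingProb R (u n)) atTop (𝓝 (g (crossRatio x)))`
  (the hypothesis of the crux);
* `SLIM u κ` := for every Dobrushin domain `D` and every admissible `ℤ²`-discretisation family
  `E` of `D` (`ZdDiscretisationFamily D E`) there is an SLE_κ law `μ` in `D` (`IsSLELaw κ D μ`) with
  `∀ F : CurveClass ℂ →ᵇ ℝ, Tendsto (fun n ↦ ∫ ω, F (bondInterfaceIn D (E (u n)) ω) ∂P_{1/2}) atTop (𝓝 (∫ γ, F γ ∂μ))`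
  — "along the meshes `u n` the medial exploration interface of critical bond percolation converges
  in law to chordal SLE_κ in every discretised Dobrushin domain" (the body of the tree conjecture
  `SLE6LimitZ2AllDiscretisations` with `6 ↦ κ` and the mesh filter replaced by the sequence `u`).

The three registered stubs (device D-0027 §3.3, as in the sibling lines of `Cruxes/CardyRigidity/`:
each stub is a sorried `protected theorem Holds.stub_<name> : <statement over tree declarations>`
plus the by-name handle `def stub_<name> : Prop := type_of% Holds.stub_<name>`; the hypotheses of
`SubseqRigidity_of` are the three handles, by name):

* STUB A `stub_seqInterfacesToSLE` (XL — the heart; Camia–Newman / Smirnov Thm 2 with an unknown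
  kernel, along a sequence).  `u → 0⁺ ∧ SHYP u g ⇒ ∃ κ > 0, SLIM u κ`.  Why plausibly true:
  Aizenman–Burchard tightness (tree fact `isTightLaws_map_bondInterface`) + RSW (`rsw_half_holds`)
  give subsequential limits of the interface along sub-subsequences of `u`; the kernel `g`
  (conformally invariant BY HYPOTHESIS: it is a function of the cross-ratio) identifies every such
  limit as a conformally invariant domain-Markov chordal curve, i.e. chordal SLE_κ for one `κ`
  determined by `g` (Schramm's principle), and uniqueness of the SLE_κ law (`IsSLECurve.map_eq_holds`)
  upgrades sub-subsequential convergence to convergence along all of `u`.  Risk = the crux's recorded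
  risk: `SHYP` gives kernels of fixed JORDAN rectangles, the Markov step needs kernels of moving slit
  domains (pointwise → locally uniform bridge by RSW equicontinuity + Carathéodory; Camia–Newman 2007
  Thm 3, Rem. 5.4; Binder–Chayes–Lei 2010).  `κ` is NOT asserted `> 4` or `= 6` — the composition
  derives both.
* STUB B `stub_seqCrossingReadout` (L; portmanteau for the open-crossing event along `u`).
  `u → 0⁺ ∧ SHYP u g ∧ SLIM u κ ⇒` in every conformal rectangle `R = (Ω; a, b, c, d)` every SLE_κ law
  of `(Ω; a, c) = R.chord 0 2` hits `(cd)` before `(bc)` with probability `g (crossRatio x)` for every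
  uniformizing datum `(φ, x)`.  Why plausibly true: the discrete event "the `a → c` interface hits
  `(cd)_δ` before `(bc)_δ`" IS the open crossing `(ab)_δ ↔ (cd)_δ` (exactly, at every mesh `u n`, for
  a hands-off discretisation family of `R.chord 0 2`); its probability tends to `g (crossRatio x)` by
  `SHYP` and to `μ (hitsBefore (cd) (bc))` by `SLIM` (a continuity set of the SLE_κ law: RSW boundary
  estimates / non-tangential boundary hitting), and any two SLE_κ laws of `R.chord 0 2` coincide
  (`IsSLECurve.map_eq_holds`).
* STUB C `stub_seqLimitIsTargetIndependent` (L; Lawler–Schramm–Werner locality in SPLITTING form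
  passes to the sequential limit).  `SLIM u κ` for some `u → 0⁺ ⇒` some family of chordal SLE_κ laws
  (one per Dobrushin domain) is `ChordalFamily.IsTargetIndependent` (LSW 2001 Cor. 2.3 / Werner 2007
  Prop. 3.4): at the lattice level the explorations of `(D; a, b)` and `(D; a, b')` coincide edge by
  edge until they reach `[b, b']` (exactly, for hands-off discretisations — cf. the `LagHandOff`
  machinery of route `CardySelfRefinement`); pass to the limit along `u n` on `stopAt` events;
  discretisation families exist for every Dobrushin domain
  (`Theorems/CardySelfRefinementDiscretisationFamilyExists.lean`).
* COMPOSITION `SubseqRigidity_of` (PROVED below, no `sorry`, ≈ 45 lines): A gives `κ > 0` and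
  `SLIM u κ`; C gives a target-independent family `Q` of SLE_κ laws; `κ > 4` because for `κ ≤ 4`
  STUB B and Rohde–Schramm's simple phase (`measureReal_hitsBefore_eq_zero_of_le_four`, fed with
  `ae_isSimpleTrace_sleTrace_of_le_four_holds` and `JordanDomain.exists_continuousOn_extension_holds`)
  would give `g (η₀) = 0` at the modulus `η₀` of the unit-disc rectangle, so that — NEW w.r.t. the
  filter version — `0` would be a cluster point of the crossing probabilities along `𝓝[>] 0`
  (`MapClusterPt.of_comp` along the sequence `u`), contradicting RSW
  (`discreteCrossingProb_clusterPt_mem_Ioo_holds`); then `κ = 6` by the PROVED LSW characterisation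
  `eq_six_of_isSLELaw_of_isTargetIndependent_of_four_lt`; finally every `η ∈ (0,1)` is the modulus of
  a Carleson-triangle rectangle carrying an SLE₆ law (`exists_isSLELaw_cardyFunction_crossRatio_eq_at`,
  `exists_isSLECurve_six`, injectivity of `F` via `strictMonoOn_cardyFunction_holds`,
  `cardyFunction_mem_Ioo`), where B evaluates `g η` as the SLE₆ crossing probability `= F η`
  (`sle_six_measureReal_hitsBefore_holds`, Cardy's formula for SLE₆, proved in the tree).

## Disproof used
No `Cruxes/SubseqRigidity/Disproof.lean` exists (`ledger crux ls stmt-CriticalPhenomena-8271`: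
no workfiles, 2026-08-17): no `_false_without_` obstruction to honour, no landed `Negative/` lemma.
Negatives index (`ledger negatives --problem CriticalPhenomena`): stmt-0698 (`¬ SymmetryUpgrade`:
an abstract local / Markov / similarity-covariant family need not be SLE₆ — fat-germ surgery) is
NOT instantiated: no stub is an axioms-⇒-SLE characterisation; C produces a family of SLE_κ LAWS of
the concrete bond-`ℤ²` interface limits and the κ-pinning is the proved LSW theorem; stmt-0748
(`NegDegenerateArcs`, refuted) is used positively (RSW cluster points in `(0,1)`).

## Barriers
`EmbeddingModulusUniqueness` (Beffara 2008 Prop. 4: no embedding-blind proof of conformal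
invariance) — not in class: conformal invariance of the kernel along `u` is the HYPOTHESIS (`g` of
the cross-ratio), the line only identifies the kernel; `ScaleCovarianceNotMoebius` — not in play
(no symmetry upgrade is attempted here; that is the business of the route's other cruxes);
`SmirnovTriangularOnly` / `FKParafermionicHalfCauchyRiemann` / `CoveringLatticeShift` — no discrete
holomorphic observable and no lattice rewriting is used.
-/

noncomputable section

open scoped NNReal BoundedContinuousFunction
open MeasureTheory Filter Set Topology
open UpperHalfPlane (upperHalfPlaneSet)
open Literature.Probability.RandomPlanarGeometry Literature.Probability.LatticeModels
open Literature.Probability.Percolation hiding cardyFunction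

namespace Summit.CriticalPhenomena.CardyFormulaZ2.Cruxes.SubseqRigidity.Birth

/-- STUB A — **along the meshes `u n`, the interfaces converge to some SLE_κ** (Camia–Newman 2007
§§5–7 / Smirnov 2001 Thm 2 run with the unknown conformally invariant crossing kernel `g` along a
sequence; Aizenman–Burchard tightness; Schramm 2000 §1.5; uniqueness of the SLE_κ law upgrades
sub-subsequential limits to the whole sequence).  If `u n → 0⁺` and the bond-`ℤ²` crossing
probabilities of all conformal rectangles converge along `u n` to `g` of the cross-ratio, then
there is `κ > 0` such that for every Dobrushin domain `D` and every admissible `ℤ²`-discretisation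
family `E` of `D` the medial exploration interface `bondInterfaceIn D (E (u n))` of `P_{1/2}`
converges in law (bounded continuous test functions on `CurveClass ℂ`) to an SLE_κ law in `D`. -/
protected theorem Holds.stub_seqInterfacesToSLE :
    ∀ u : ℕ → ℝ, Tendsto u atTop (𝓝[>] (0 : ℝ)) → ∀ g : ℝ → ℝ,
      (∀ (R : ConformalRectangle) (φ : ConformalEquiv upperHalfPlaneSet R.carrier) (x : Fin 4 → ℝ),
          R.IsUniformizing φ x →
            Tendsto (fun n ↦ bondDomainCrossingProb R (u n)) atTop (𝓝 (g (crossRatio x)))) →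
      ∃ κ : ℝ≥0, 0 < κ ∧
        ∀ (D : DobrushinDomain) (E : ℝ → DiscreteDobrushin), ZdDiscretisationFamily D E →
          ∃ μ : Measure (CurveClass ℂ), IsSLELaw κ D μ ∧
            ∀ F : CurveClass ℂ →ᵇ ℝ,
              Tendsto (fun n ↦ ∫ ω, F (bondInterfaceIn D (E (u n)) ω) ∂(bondPercolation (zdGraph 2) half))
                atTop (𝓝 (∫ γ, F γ ∂μ)) := by
  sorry

/-- By-name handle of the registered stub `Holds.stub_seqInterfacesToSLE` (D-0027 §3.3 device). -/
def stub_seqInterfacesToSLE : Prop := type_of% Holds.stub_seqInterfacesToSLE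

/-- STUB B — **crossing readout along the sequence** (portmanteau for the open-crossing event;
Camia–Newman 2007 §7, Werner 2007 §3; cf. crux `SLESixFamiliesGiveCardy` of route
`CardyComplexCone`).  If `u n → 0⁺`, the crossing probabilities converge along `u n` to `g` of the
cross-ratio AND along `u n` the interfaces converge to SLE_κ laws in all discretised Dobrushin
domains, then in every conformal rectangle `R = (Ω; a, b, c, d)` every SLE_κ law of `(Ω; a, c)`
hits `(cd)` before `(bc)` with probability `g (crossRatio x)` for every uniformizing datum
`(φ, x)`: the two limits of `bondDomainCrossingProb R (u n)` agree. -/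
protected theorem Holds.stub_seqCrossingReadout :
    ∀ u : ℕ → ℝ, Tendsto u atTop (𝓝[>] (0 : ℝ)) → ∀ (g : ℝ → ℝ) (κ : ℝ≥0), 0 < κ →
      (∀ (R : ConformalRectangle) (φ : ConformalEquiv upperHalfPlaneSet R.carrier) (x : Fin 4 → ℝ),
          R.IsUniformizing φ x →
            Tendsto (fun n ↦ bondDomainCrossingProb R (u n)) atTop (𝓝 (g (crossRatio x)))) →
      (∀ (D : DobrushinDomain) (E : ℝ → DiscreteDobrushin), ZdDiscretisationFamily D E →
          ∃ μ : Measure (CurveClass ℂ), IsSLELaw κ D μ ∧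
            ∀ F : CurveClass ℂ →ᵇ ℝ,
              Tendsto (fun n ↦ ∫ ω, F (bondInterfaceIn D (E (u n)) ω) ∂(bondPercolation (zdGraph 2) half))
                atTop (𝓝 (∫ γ, F γ ∂μ))) →
      ∀ (R : ConformalRectangle) (μ : Measure (CurveClass ℂ))
        (φ : ConformalEquiv upperHalfPlaneSet R.carrier) (x : Fin 4 → ℝ),
        IsSLELaw κ (R.chord 0 2 (by decide)) μ → R.IsUniformizing φ x →
          μ.real (CurveClass.hitsBefore (R.arc 2) (R.arc 1)) = g (crossRatio x) := by
  sorry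

/-- By-name handle of the registered stub `Holds.stub_seqCrossingReadout` (D-0027 §3.3 device). -/
def stub_seqCrossingReadout : Prop := type_of% Holds.stub_seqCrossingReadout

/-- STUB C — **locality (splitting form) passes to the sequential scaling limit**
(Lawler–Schramm–Werner 2001 Cor. 2.3 / Werner 2007 Prop. 3.4: the percolation exploration from `a`
in `(D; a, b, b')` does not know its target before it reaches the arc `[b, b']` — exactly, at
every mesh `u n`, for hands-off discretisations; passage to the limit along `u n` on `stopAt`
events).  If along some sequence of meshes `u n → 0⁺` the interfaces converge to SLE_κ laws in all
discretised Dobrushin domains, then some family of chordal SLE_κ laws (one for each Dobrushin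
domain) is target independent. -/
protected theorem Holds.stub_seqLimitIsTargetIndependent :
    ∀ κ : ℝ≥0, 0 < κ → ∀ u : ℕ → ℝ, Tendsto u atTop (𝓝[>] (0 : ℝ)) →
      (∀ (D : DobrushinDomain) (E : ℝ → DiscreteDobrushin), ZdDiscretisationFamily D E →
          ∃ μ : Measure (CurveClass ℂ), IsSLELaw κ D μ ∧
            ∀ F : CurveClass ℂ →ᵇ ℝ,
              Tendsto (fun n ↦ ∫ ω, F (bondInterfaceIn D (E (u n)) ω) ∂(bondPercolation (zdGraph 2) half))
                atTop (𝓝 (∫ γ, F γ ∂μ))) →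
      ∃ Q : ChordalFamily,
        (∀ D : DobrushinDomain, IsSLELaw κ D (Q D)) ∧ Q.IsTargetIndependent := by
  sorry

/-- By-name handle of the registered stub `Holds.stub_seqLimitIsTargetIndependent` (D-0027 §3.3 device). -/
def stub_seqLimitIsTargetIndependent : Prop := type_of% Holds.stub_seqLimitIsTargetIndependent

/-- The unit-disc rectangle with its last mark dropped: a three-marked Jordan domain, the witness
the Lawler–Schramm–Werner characterisation is read at. -/
def threeMarkedDisc : MarkedDomain 3 where
  toJordanDomain := ConformalRectangle.unitDisc.toJordanDomain
  mark i := ConformalRectangle.unitDisc.mark i.castSucc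
  strictMono_mark _ _ h :=
    ConformalRectangle.unitDisc.strictMono_mark (Fin.castSucc_lt_castSucc_iff.mpr h)
  mark_mem i := ConformalRectangle.unitDisc.mark_mem i.castSucc

/-- **Composition** (kernel-checked, no `sorry`): STUBS A–C imply the crux `SubseqRigidity` of
route `CardyMirrorMonotone` (stmt-CriticalPhenomena-8271), BY NAME. -/
theorem SubseqRigidity_of :
    stub_seqInterfacesToSLE → stub_seqCrossingReadout → stub_seqLimitIsTargetIndependent →
      Summit.CriticalPhenomena.CardyFormulaZ2.Theses.CardyMirrorMonotone.SubseqRigidity := by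
  intro hA hB hC
  dsimp only [stub_seqInterfacesToSLE, stub_seqCrossingReadout, stub_seqLimitIsTargetIndependent]
    at hA hB hC
  intro u hu g hg η hη
  -- STUB A: along `u n` the interfaces converge to SLE_κ laws for one κ > 0
  obtain ⟨κ, hκ, hconv⟩ := hA u hu g hg
  -- STUB C: a target-independent family of SLE_κ laws
  obtain ⟨Q, hQ, hT⟩ := hC κ hκ u hu hconv
  -- κ > 4: otherwise the SLE_κ crossing probability vanishes (Rohde–Schramm simple phase), while
  -- by STUB B it is the limit g(η₀) of percolation crossing probabilities along `u n`, and RSW keeps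
  -- every cluster point of those in (0,1)
  have h4 : 4 < κ := by
    refine lt_of_not_ge fun hle ↦ ?_
    set R₀ : ConformalRectangle := ConformalRectangle.unitDisc
    obtain ⟨φ₀, x₀, hφ₀⟩ := MarkedDomain.exists_isUniformizing_holds R₀
    have hμ₀ : IsSLELaw κ (R₀.chord 0 2 (by decide)) (Q (R₀.chord 0 2 (by decide))) := hQ _
    have hzero :
        (Q (R₀.chord 0 2 (by decide))).real (CurveClass.hitsBefore (R₀.arc 2) (R₀.arc 1)) = 0 :=
      measureReal_hitsBefore_eq_zero_of_le_four
        (fun κ ↦ ae_isSimpleTrace_sleTrace_of_le_four_holds (κ := κ))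
        JordanDomain.exists_continuousOn_extension_holds hκ hle R₀ hμ₀
    have hker₀ := hB u hu g κ hκ hg hconv R₀ _ φ₀ x₀ hμ₀ hφ₀
    have hg0 : g (crossRatio x₀) = 0 := hker₀.symm.trans hzero
    -- the crossing probabilities of R₀ tend to g (crossRatio x₀) = 0 along `u n` …
    have htend : Tendsto (fun n ↦ bondDomainCrossingProb R₀ (u n)) atTop (𝓝 0) := by
      simpa only [hg0] using hg R₀ φ₀ x₀ hφ₀
    -- … so 0 is a cluster point of the crossing probabilities as the mesh tends to 0⁺ …
    have hclu : MapClusterPt (0 : ℝ) (𝓝[>] (0 : ℝ))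
        (fun δ ↦ discreteCrossingProb half R₀.carrier δ (R₀.arc 0) (R₀.arc 2)) :=
      MapClusterPt.of_comp (φ := u) (p := atTop) hu htend.mapClusterPt
    -- … contradicting RSW
    exact (lt_irrefl (0 : ℝ)) (discreteCrossingProb_clusterPt_mem_Ioo_holds R₀ hclu).1
  -- Lawler–Schramm–Werner: a target-independent family of SLE_κ laws, κ > 4, has κ = 6 (tree theorem)
  have h6 : κ = 6 := eq_six_of_isSLELaw_of_isTargetIndependent_of_four_lt h4 hQ hT threeMarkedDisc
  subst h6
  -- realise η as the cross-ratio of a uniformizing datum of a rectangle carrying an SLE₆ law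
  have hs : cardyFunction η ∈ Ioo (0 : ℝ) 1 := cardyFunction_mem_Ioo hη
  obtain ⟨R, μ, φ, x, hμ, hφ, hval⟩ :=
    exists_isSLELaw_cardyFunction_crossRatio_eq_at (κ := 6) exists_isSLECurve_six hs
  have hx : crossRatio x ∈ Ioo (0 : ℝ) 1 :=
    ConformalRectangle.crossRatio_mem_Ioo_of_isUniformizing hφ
  have hmono : StrictMonoOn cardyFunction (Icc 0 1) := strictMonoOn_cardyFunction_holds
  have hxη : crossRatio x = η :=
    hmono.injOn ⟨hx.1.le, hx.2.le⟩ ⟨hη.1.le, hη.2.le⟩ hval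
  -- STUB B at κ = 6: g (crossRatio x) is the SLE₆ crossing probability, = F (crossRatio x)
  have hker : μ.real (CurveClass.hitsBefore (R.arc 2) (R.arc 1)) = g (crossRatio x) :=
    hB u hu g 6 hκ hg hconv R μ φ x hμ hφ
  have hcardy : μ.real (CurveClass.hitsBefore (R.arc 2) (R.arc 1)) = cardyFunction (crossRatio x) :=
    sle_six_measureReal_hitsBefore_holds R hμ hφ
  rw [← hxη, ← hker, hcardy]

/-- The composition applied to the three registered stubs: the crux, conditionally on the stubs
(the only `sorry`s of this file are inside `Holds.stub_*`); checks mechanically that the stub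
statements are literally the hypotheses of `SubseqRigidity_of`. -/
theorem subseqRigidity_of_stubs :
    Summit.CriticalPhenomena.CardyFormulaZ2.Theses.CardyMirrorMonotone.SubseqRigidity :=
  SubseqRigidity_of Holds.stub_seqInterfacesToSLE Holds.stub_seqCrossingReadout
    Holds.stub_seqLimitIsTargetIndependent

end Summit.CriticalPhenomena.CardyFormulaZ2.Cruxes.SubseqRigidity.Birth

end
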